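import Summits.QuantumFields.GaugeBoot.WordSymmetry
import HarnessLib

/-!
# Gauge-boot / ym-instrument: rectangular Wilson loops as lattice words (binding glue)

Cell `ym-instrument` (HOME `run/shared/lean/pub/ym-instrument/`, HUMAN RULING D-0084 (2); crew (a) Lean typist),
inheriting the word layer of cell `pub-gaugeboot` (`LatticeWords`, `WordLoop`, `WordSymmetry`, `OrbitAverages`).

HONEST FRAMING (page 1 of every file of this cell): this file certifies NOTHING numerically; it is vocabulary glue.
The instrument cell produces certified bounds on lattice expectations at STATED `(G, D, L, β)`; NOT a mass gap,
NOT a continuum limit, NOT a string tension; nothing here is summit-bearing until typed as a hypothesis-free theorem.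

## Content

The loop-equation / positivity certificates of the bootstrap speak about expectations `⟨W_x(w)⟩` of loop variables
of lattice WORDS (`wordLoop ρ x w`), while the instrument questions Q-A1/Q-A2 (`pub/ym-instrument/QUESTIONS.md`)
are asked about the tree's RECTANGULAR Wilson loops `W̄(R×T)` (`wilsonLoopExpectation N D L β R T`, built on the
Literature observable `wilsonLoop ρ x i j R T` / `rectangleHolonomy`). This module identifies the two:

* `Word.line k n` — the straight word of `n` forward steps along axis `k`; `Word.rectangle i j R T` — the word
  `(+e_i)^R (+e_j)^T (−e_i)^R (−e_j)^T` of the `R × T` rectangle in the `(i, j)` plane;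
* `wordHolonomy_line = lineHolonomy`, `wordHolonomy_rectangle = rectangleHolonomy` (this pins the orientation and
  product-order conventions of the Literature `rectangleHolonomy` in the word calculus), `endpoint_rectangle`
  (the rectangle word is closed), `wordLoop_rectangle : wordLoop ρ x (rectangle i j R T) = wilsonLoop ρ x i j R T`;
* `wilsonLoopExpectation_eq_wordLoop`: for `SU(N)` at standard coupling `β_std` on `(ℤ/L)^D`, every base point `x`
  and every pair of distinct axes `i ≠ j`, `⟨W̄(R×T)⟩ = ⟨W_x(rectangle i j R T)⟩` (orbit average = local expectation,
  `wilsonExpectation_meanWilsonLoop_eq_wilsonLoop`), and the `1 × 1` case `Word.rectangle i j 1 1 = Word.plaquette i j`.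

This is exactly the lemma a kernel binding of a certified `W̄(1×2)` / `W̄(2×2)` window needs (the certificate's objective
column is a word; the theorem is about `wilsonLoopExpectation`). Everything is `[folklore]`.

References: K. G. Wilson, Phys. Rev. D 10 (1974) 2445; M. Creutz, Phys. Rev. D 21 (1980) 2308 (`W(R,T)`);
loops as reduced words: Kazakov–Zheng arXiv:2404.16925 §2, Guo–Li–Yang–Zhu arXiv:2502.14421 §2.
-/

noncomputable section

open Literature.MathematicalPhysics.QuantumFieldTheory

namespace Summit.QuantumFields.GaugeBoot

variable {d L : ℕ}

namespace Word

/-- The straight word `(+e_k)^n` of `n` forward steps along axis `k`. [folklore] -/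
def line (k : Fin d) (n : ℕ) : Word d := List.replicate n (.fwd k)

/-- The rectangle word `(+e_i)^R (+e_j)^T (−e_i)^R (−e_j)^T` of the `R × T` rectangle in the `(i, j)` plane
(`R` steps along `i` first, as in the Literature `rectangleHolonomy`). [folklore] -/
def rectangle (i j : Fin d) (R T : ℕ) : Word d :=
  line i R ++ line j T ++ List.replicate R (.bwd i) ++ List.replicate T (.bwd j)

/-- Unfolding lemma `line_zero`. [folklore] -/
@[simp] theorem line_zero (k : Fin d) : line k 0 = [] := rfl

/-- Unfolding lemma `line_succ`. [folklore] -/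
theorem line_succ (k : Fin d) (n : ℕ) : line k (n + 1) = .fwd k :: line k n := rfl

/-- The reverse of a straight forward word is the straight backward word. [folklore] -/
theorem reverse_line (k : Fin d) (n : ℕ) : reverse (line k n) = List.replicate n (.bwd k) := by
  simp [Word.reverse, line, Step.inv]

/-- The rectangle word as forward segments followed by the reverses of forward segments. [folklore] -/
theorem rectangle_eq (i j : Fin d) (R T : ℕ) :
    rectangle i j R T = line i R ++ line j T ++ reverse (line i R) ++ reverse (line j T) := by
  rw [rectangle, reverse_line, reverse_line]

/-- Endpoint of a straight word: `x + n e_k`. [folklore] -/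
theorem endpoint_line (x : Site d L) (k : Fin d) (n : ℕ) :
    endpoint x (line k n) = x + Pi.single k (n : ZMod L) := by
  induction n generalizing x with
  | zero => simp
  | succ n ih =>
    rw [line_succ, endpoint_cons, ih]
    simp only [Step.apply, Site.shift, Nat.cast_succ, Pi.single_add]
    abel

/-- The rectangle word is closed. [folklore] -/
@[simp] theorem endpoint_rectangle (x : Site d L) (i j : Fin d) (R T : ℕ) :
    endpoint x (rectangle i j R T) = x := by
  have h : endpoint x (line i R ++ line j T) = endpoint (endpoint x (line j T)) (line i R) := by
    rw [endpoint_append, endpoint_line, endpoint_line, endpoint_line, endpoint_line]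
    abel
  rw [rectangle_eq, endpoint_append, endpoint_append, h, endpoint_reverse, endpoint_reverse]

/-- The `1 × 1` rectangle word is the plaquette word. [folklore] -/
@[simp] theorem rectangle_one_one (i j : Fin d) : rectangle i j 1 1 = plaquette i j := rfl

/-- Length of the rectangle word = perimeter `2(R + T)`. [folklore] -/
@[simp] theorem length_rectangle (i j : Fin d) (R T : ℕ) : (rectangle i j R T).length = 2 * (R + T) := by
  simp only [rectangle, line, List.length_append, List.length_replicate]
  ring

end Word

section Holonomy

variable {G : Type*} [Group G]

/-- The straight word carries the Literature line holonomy. [folklore] -/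
theorem wordHolonomy_line (U : GaugeConfig d L G) (k : Fin d) (n : ℕ) (y : Site d L) :
    wordHolonomy U y (Word.line k n) = lineHolonomy U k n y := by
  induction n generalizing y with
  | zero => rfl
  | succ n ih =>
    rw [Word.line_succ, wordHolonomy_cons, ih]
    rfl

/-- **The rectangle word carries the Literature rectangle holonomy** (this pins the conventions of
`rectangleHolonomy`: `R` links along `i`, `T` along `j`, back along `i`, back along `j`). [folklore] -/
theorem wordHolonomy_rectangle (U : GaugeConfig d L G) (x : Site d L) (i j : Fin d) (R T : ℕ) :
    wordHolonomy U x (Word.rectangle i j R T) = rectangleHolonomy U x i j R T := by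
  have h1 : Word.endpoint x (Word.line i R) = x + Pi.single i (R : ZMod L) := Word.endpoint_line x i R
  have h2 : Word.endpoint x (Word.line i R ++ Word.line j T) =
      Word.endpoint (x + Pi.single j (T : ZMod L)) (Word.line i R) := by
    rw [Word.endpoint_append, Word.endpoint_line, Word.endpoint_line, Word.endpoint_line]
    abel
  have h3 : Word.endpoint x (Word.line i R ++ Word.line j T ++ Word.reverse (Word.line i R)) =
      Word.endpoint x (Word.line j T) := by
    rw [Word.endpoint_append, h2, Word.endpoint_reverse, Word.endpoint_line]
  rw [Word.rectangle_eq, wordHolonomy_append, h3, wordHolonomy_reverse, wordHolonomy_append, h2,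
    wordHolonomy_reverse, wordHolonomy_append, h1, wordHolonomy_line, wordHolonomy_line, wordHolonomy_line,
    wordHolonomy_line, rectangleHolonomy]

end Holonomy

section LoopVariable

variable {N : ℕ} {G : Type*} [Group G] [TopologicalSpace G] [IsTopologicalGroup G]
  [CompactSpace G] [MeasurableSpace G] [BorelSpace G] (ρ : G →* Matrix (Fin N) (Fin N) ℂ)

omit [TopologicalSpace G] [IsTopologicalGroup G] [CompactSpace G] [MeasurableSpace G] [BorelSpace G] in
/-- **The loop variable of the rectangle word is the tree's rectangular Wilson loop**
`W_{R×T}(x; i, j) = (1/N) Re tr ρ(hol)`. [folklore] -/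
theorem wordLoop_rectangle (x : Site d L) (i j : Fin d) (R T : ℕ) :
    wordLoop ρ x (Word.rectangle i j R T) = wilsonLoop (G := G) ρ x i j R T := by
  funext U
  simp only [wordLoop, wilsonLoop, wordHolonomy_rectangle]

/-- Expectation form: `⟨W_x(rectangle i j R T)⟩_β = ⟨W_{R×T}(x; i, j)⟩_β` in any torus Wilson state. [folklore] -/
theorem wilsonExpectation_wordLoop_rectangle [NeZero L] (β : ℝ) (x : Site d L) (i j : Fin d) (R T : ℕ) :
    wilsonExpectation ρ β (wordLoop (G := G) ρ x (Word.rectangle i j R T)) =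
      wilsonExpectation ρ β (wilsonLoop ρ x i j R T) := by
  rw [wordLoop_rectangle]

end LoopVariable

section Targets

/-- **`⟨W̄(R×T)⟩ = ⟨W_x(rectangle i j R T)⟩`**: the torus-averaged `R × T` Wilson-loop expectation of `SU(N)` at
standard coupling `β_std` on `(ℤ/L)^D` (`wilsonLoopExpectation`, tree coupling `β_std / N`) is the expectation of the
loop variable of the rectangle word at ANY base point in ANY coordinate plane `i ≠ j` (translation and hyperoctahedral
invariance of the torus Wilson state, `wilsonExpectation_meanWilsonLoop_eq_wilsonLoop`). This is the identification a
kernel binding of a certified Wilson-loop window consumes. [folklore] -/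
theorem wilsonLoopExpectation_eq_wordLoop (N D L : ℕ) [NeZero L] (β : ℝ) (R T : ℕ) (x : Site D L)
    {i j : Fin D} (hij : i ≠ j) :
    wilsonLoopExpectation N D L β R T =
      wilsonExpectation (suRep N) (β / N) (wordLoop (suRep N) x (Word.rectangle i j R T)) := by
  unfold wilsonLoopExpectation
  rw [wilsonExpectation_meanWilsonLoop_eq_wilsonLoop (suRep N) (continuous_suRep N) _ R T x hij,
    wordLoop_rectangle]

/-- The plaquette case: `⟨ū_P⟩ = ⟨W_x(rectangle i j 1 1)⟩`. [folklore] -/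
theorem plaquetteExpectation_eq_wordLoop_rectangle (N D L : ℕ) [NeZero L] (β : ℝ) (x : Site D L)
    {i j : Fin D} (hij : i ≠ j) :
    plaquetteExpectation N D L β =
      wilsonExpectation (suRep N) (β / N) (wordLoop (suRep N) x (Word.rectangle i j 1 1)) := by
  rw [← wilsonLoopExpectation_one_one, wilsonLoopExpectation_eq_wordLoop N D L β 1 1 x hij]

end Targets

end Summit.QuantumFields.GaugeBoot

end
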